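import Mathlib
import Summits.MatrixMultiplication.MatrixMultiplication.Theorems.SoloInformedCwTwoGroupRigidity

/-!
# Weights of monomial degenerations onto `cw₂^{⊠N}` are additive (digital)

A monomial degeneration of a group structure tensor onto the Kronecker power `cw₂^{⊠N}` carries,
besides the group realization of the support `S_N` (digital by `exists_digits_of_realizes`),
real weight functions `A, B, C` on the three index sets with `A u + B v + C w = 0` for every
`(u,v,w) ∈ S_N` (and `> 0` on the other triples of the group hyperplane).  Applying the rigidity
theorem to the group `(ℝ,+)` shows that the WEIGHTS ARE DIGITAL TOO: there are digit weights
`α_k : Fin 3 → ℝ`, `α_k 0 = 0`, with `A u = A 0 + Σ_k α_k u_k`, `B v = B 0 + Σ_k α_k v_k`,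
`C w = −A 0 − B 0 − Σ_k (α_k 1 + α_k 2) + Σ_k α_k w_k` (`exists_additive_digits_of_zero_on_support`);
consequently `A u + B v + C w = Σ_k (α_k u_k + α_k v_k + α_k w_k − α_k 1 − α_k 2)` for ALL triples
(`weight_sum_eq_excess`), which is the excess functional appearing as hypothesis `H` in
`SoloInformedCwTwoAPDigits` / `SoloInformedCwTwoCharTwo`.  This justifies treating the weighted
digit-design problem (soloist door D6) as a finite linear program in the `2N` unknowns
`α_k 1, α_k 2`.

Also recorded: in a commutative group the ordered digit product is the `Finset` product
(`digitProd_eq_prod`).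

No `sorry`; axioms `propext`, `Classical.choice`, `Quot.sound`.
-/

namespace Summit.MatrixMultiplication.MatrixMultiplication.Theorems

open Finset

section CwTwoWeights

variable {N : ℕ}

/-- In a commutative group the ordered digit product `digitProd g u m` is the product of the
digits with index `< m`. -/
theorem digitProd_eq_prod_ite {G : Type*} [CommGroup G] (g : Fin N → Fin 3 → G)
    (u : Fin N → Fin 3) (m : ℕ) :
    digitProd g u m = ∏ k : Fin N, (if k.val < m then g k (u k) else 1) := by
  induction m with
  | zero => simp [digitProd]
  | succ m ih =>
    rw [digitProd, ih]
    by_cases hm : m < N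
    · rw [dif_pos hm]
      have split : ∀ k : Fin N, (if k.val < m + 1 then g k (u k) else 1) =
          (if k.val < m then g k (u k) else 1) * (if k = ⟨m, hm⟩ then g k (u k) else 1) := by
        intro k
        by_cases h1 : k.val < m
        · have hne : k ≠ ⟨m, hm⟩ := by intro h; rw [h] at h1; exact lt_irrefl _ h1
          simp [h1, hne, show k.val < m + 1 by omega]
        · by_cases h2 : k = ⟨m, hm⟩
          · subst h2; simp
          · have hne : k.val ≠ m := fun h => h2 (Fin.ext h)
            simp [h1, h2, show ¬ k.val < m + 1 by omega]
      rw [Finset.prod_congr rfl (fun k _ => split k), Finset.prod_mul_distrib,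
        Finset.prod_ite_eq']
      simp
    · rw [dif_neg hm, mul_one]
      refine Finset.prod_congr rfl (fun k _ => ?_)
      have hk := k.isLt
      simp [show k.val < m by omega, show k.val < m + 1 by omega]

/-- In a commutative group, `digitProd g u N = ∏ k, g k (u k)`. -/
theorem digitProd_eq_prod {G : Type*} [CommGroup G] (g : Fin N → Fin 3 → G)
    (u : Fin N → Fin 3) : digitProd g u N = ∏ k : Fin N, g k (u k) := by
  rw [digitProd_eq_prod_ite]
  exact Finset.prod_congr rfl (fun k _ => by simp [k.isLt])

/-- **Weights are digital.**  Real functions `A, B, C` on words with `A u + B v + C w = 0` on the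
support `S_N` of `cw₂^{⊠N}` are sums of digit weights (rigidity over the group `(ℝ,+)`). -/
theorem exists_additive_digits_of_zero_on_support (A B C : (Fin N → Fin 3) → ℝ)
    (h : ∀ u v w : Fin N → Fin 3, (∀ i, u i ≠ v i ∧ v i ≠ w i ∧ u i ≠ w i) →
      A u + B v + C w = 0) :
    ∃ α : Fin N → Fin 3 → ℝ, (∀ k, α k 0 = 0) ∧
      (∀ u, A u = A 0 + ∑ k, α k (u k)) ∧
      (∀ v, B v = B 0 + ∑ k, α k (v k)) ∧
      (∀ w, C w = -(A 0) - B 0 - (∑ k, (α k 1 + α k 2)) + ∑ k, α k (w k)) := by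
  have h' : ∀ u v w : Fin N → Fin 3, (∀ i, u i ≠ v i ∧ v i ≠ w i ∧ u i ≠ w i) →
      (fun u => Multiplicative.ofAdd (A u)) u * (fun v => Multiplicative.ofAdd (B v)) v *
        (fun w => Multiplicative.ofAdd (C w)) w = 1 := by
    intro u v w huvw
    show Multiplicative.ofAdd (A u) * Multiplicative.ofAdd (B v) * Multiplicative.ofAdd (C w) = 1
    rw [← ofAdd_add, ← ofAdd_add, h u v w huvw, ofAdd_zero]
  obtain ⟨g, hg0, -, h₁, h₂, h₃⟩ := exists_digits_of_realizes
    (fun u => Multiplicative.ofAdd (A u)) (fun v => Multiplicative.ofAdd (B v))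
    (fun w => Multiplicative.ofAdd (C w)) h'
  refine ⟨fun k a => Multiplicative.toAdd (g k a), fun k => by simp [hg0 k], ?_, ?_, ?_⟩
  · intro u
    have e := congrArg Multiplicative.toAdd (h₁ u)
    rw [digitProd_eq_prod] at e
    simpa [toAdd_mul, toAdd_prod] using e
  · intro v
    have e := congrArg Multiplicative.toAdd (h₂ v)
    rw [digitProd_eq_prod] at e
    simp only [toAdd_mul, toAdd_prod, toAdd_ofAdd] at e
    rw [e, add_comm]
  · intro w
    have e := congrArg Multiplicative.toAdd (h₃ w)
    rw [digitProd_eq_prod, digitProd_eq_prod, digitProd_eq_prod] at e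
    simp only [toAdd_mul, toAdd_inv, toAdd_prod, toAdd_ofAdd] at e
    rw [e, Finset.sum_add_distrib]
    ring

/-- **The excess functional.**  With digital weights as above, for EVERY triple of words
`A u + B v + C w = Σ_k (α_k u_k + α_k v_k + α_k w_k − (α_k 1 + α_k 2))`. -/
theorem weight_sum_eq_excess (A B C : (Fin N → Fin 3) → ℝ) (α : Fin N → Fin 3 → ℝ)
    (hA : ∀ u, A u = A 0 + ∑ k, α k (u k)) (hB : ∀ v, B v = B 0 + ∑ k, α k (v k))
    (hC : ∀ w, C w = -(A 0) - B 0 - (∑ k, (α k 1 + α k 2)) + ∑ k, α k (w k))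
    (u v w : Fin N → Fin 3) :
    A u + B v + C w = ∑ k, (α k (u k) + α k (v k) + α k (w k) - (α k 1 + α k 2)) := by
  rw [hA u, hB v, hC w]
  simp only [Finset.sum_add_distrib, Finset.sum_sub_distrib]
  ring

/-- **Corollary (the weighted design condition is a condition on digit weights).**  If
`A u + B v + C w` vanishes on `S_N` and is positive on a set `T` of triples, then there are digit
weights `α` (`α_k 0 = 0`) whose excess is positive on `T`. -/
theorem exists_digit_weights_pos (A B C : (Fin N → Fin 3) → ℝ)
    (h : ∀ u v w : Fin N → Fin 3, (∀ i, u i ≠ v i ∧ v i ≠ w i ∧ u i ≠ w i) →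
      A u + B v + C w = 0)
    (T : (Fin N → Fin 3) → (Fin N → Fin 3) → (Fin N → Fin 3) → Prop)
    (hpos : ∀ u v w, T u v w → 0 < A u + B v + C w) :
    ∃ α : Fin N → Fin 3 → ℝ, (∀ k, α k 0 = 0) ∧
      ∀ u v w, T u v w → 0 < ∑ k, (α k (u k) + α k (v k) + α k (w k) - (α k 1 + α k 2)) := by
  obtain ⟨α, hα0, hA, hB, hC⟩ := exists_additive_digits_of_zero_on_support A B C h
  refine ⟨α, hα0, fun u v w hT => ?_⟩
  rw [← weight_sum_eq_excess A B C α hA hB hC u v w]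
  exact hpos u v w hT

end CwTwoWeights

end Summit.MatrixMultiplication.MatrixMultiplication.Theorems
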